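import Literature.Probability.RandomPlanarGeometry.HexSAWSurfaceWallDensityRenewalReward
import Literature.Probability.RandomPlanarGeometry.HexSAWSurfaceWallRenewalCubeRange
import Mathlib.Analysis.Calculus.SmoothSeries
import HarnessLib

/-!
# No kink down to `y > μ³`: the boundary free energy `κ` is differentiable, with `κ' = V/(2m)`, at every `t > log μ³`

Topic `Literature/Probability/RandomPlanarGeometry` (lane «pcv-sawmu», a-p6 g19, car «NO-KINK-CUBE»; parents, all TREE:
`HexSAWSurfaceWallDensityRenewalReward.lean` (a-idea-1 g30, car «NO-KINK»: the visit-weighted block polynomial `Λ^v_n = IPWBV n`, the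
mean number of surface visits of a block `V(y) = pwbVisitMean y`, and — for `eᵗ = y > μ⁴` — the renewal–reward formula
`ρ±(t) = V(y)/(2m(y))`, `κ` differentiable at `t`, `β` differentiable at `y`), `HexSAWSurfaceWallRenewalCubeRange.lean` (a-p6 g19:
Kesten's identity `hasSum_pwbLaw_of_cube_lt`, the finite mean `summable_mul_pwbLaw_of_cube_lt`, `pwbMean_pos_of_cube_lt` and the
envelope `pwbLaw_le_geom_cube : f_s ≤ (μ² + y^{2/3}/μ²)(μ²/y^{2/3})^s`, all on `y > μ³`, from the six-step law of
`HexSAWSurfaceWallRenewalSixStep.lean` (a-idea-1 g33)), `HexSAWSurfaceWallRenewal.lean` (`pwbLaw`, `pwbMean`, `IPWB`, the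
entropy lemma `four_mul_visits_le`) and `HexSAWSurfaceWallDensity.lean` (`κ = wallFreeEnergy`, the one-sided densities `ρ⁺ = wallRightDensity`,
`ρ⁻ = wallLeftDensity`, which exist at every `t`); Mathlib's termwise differentiation `hasFDerivAt_tsum_of_isPreconnected`).

WHAT IS PROVED.  The parent «NO-KINK» module VERBATIM IN FORM with its hypothesis `hexConnectiveConstant ^ 4 < eᵗ` (resp. `< y`)
replaced by `hexConnectiveConstant ^ 3 < eᵗ`: for every `t` with `eᵗ = y > μ³ = (2+√2)^{3/2} ≈ 6.31`,
* §2 `summable_IPWBV_div_of_cube_lt`, `one_le_pwbVisitMean_of_cube_lt : 1 ≤ V(y)`,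
  `two_mul_pwbVisitMean_le_of_cube_lt : 2V(y) ≤ m(y) + 1`, `pwbVisitMean_pos_of_cube_lt`;
* §4 ★★ `wallRightDensity_eq_visitMean_div_of_cube_lt : ρ⁺(t) = V(y)/(2m(y))` and `wallLeftDensity_eq_visitMean_div_of_cube_lt` — the
  RENEWAL–REWARD FORMULA for the surface contact density; ★★★ `wallLeftDensity_eq_wallRightDensity_of_cube_lt : ρ⁻(t) = ρ⁺(t)` — NO
  KINK (no first-order adsorption transition) anywhere on `eᵗ > μ³`; `hasDerivAt_wallFreeEnergy_of_cube_lt`,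
  `differentiableAt_wallFreeEnergy_of_cube_lt`, `deriv_wallFreeEnergy_of_cube_lt`,
  ★★ `differentiableOn_wallFreeEnergy_of_cube_lt : DifferentiableOn ℝ κ (log μ³, ∞)`, `hasDerivAt_wallRate_of_cube_lt :
  β'(y) = β(y)V(y)/(2y m(y))`, `differentiableAt_wallRate_of_cube_lt`, ★★ `differentiableOn_wallRate_of_cube_lt :
  DifferentiableOn ℝ β (μ³, ∞)`, `mul_deriv_wallRate_div_eq_of_cube_lt : yβ'/β = V/(2m)`;
* §5 the density window `wallRightDensity_mem_Icc_visitMean_of_cube_lt : ρ⁺(t) ∈ [1/(2m), (m+1)/(4m)]` and its left twin;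
* §6 (NEW, from the six-step law itself) `three_mul_IPWBV_le : 3Λ^v_{2s} ≤ sΛ_{2s}` (`s ≥ 2`), `IPWBV_two_eq : Λ^v_2 = Λ_2`,
  ★ `three_mul_pwbVisitMean_le_of_cube_lt : 3V(y) ≤ m(y) + 2f₁(y)` and the SIX-STEP DENSITY WINDOW
  ★★ `wallRightDensity_le_sixth_window_of_cube_lt : ρ⁺(t) ≤ (m + 2f₁)/(6m) = 1/6 + f₁/(3m)` (two-step blocks have density `1/2`,
  every longer block at most `1/6`), its left twin and the crude form `wallRightDensity_le_sixth_add_of_cube_lt : ρ⁺ ≤ 1/6 + 1/(3m)`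
  — sharper than the parent's `(m+1)/(4m)` at every `y`.

THE ONE CHANGE IN THE PROOF.  The parent differentiates Kesten's identity `G(y, β(y)⁻²) = 1`, `G(y,u) = Σ_s Λ_{2s}(y) u^s`, termwise on
the box `(y₀/Λ², Λ²y₀) × (u₀/Λ, Λu₀)` with `Λ = 2/(1+θ)`, using the envelope `f_s ≤ E θ^s` and the margin `Λ²θ < 1`; there
`θ = μ²/√y₀`, `E = μ²√y₀`, and `θ < 1` iff `y₀ > μ⁴`.  Here `θ = θ₃(y₀) = μ²/y₀^{2/3}`, `E = μ² + y₀^{2/3}/μ²` (the six-step envelope of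
`HexSAWSurfaceWallRenewalCubeRange`), `θ₃ < 1` iff `y₀ > μ³` (`theta_cube_lt_one`); every other line — the coefficient bounds on the
box (which use only the parent's weaker entropy lemma `2·visits ≤ s + 1` through `two_mul_IPWBV_le` and the scaling margins), the
termwise Fréchet derivative, the one-sided chain rule along the curve `t ↦ (eᵗ, e^{−2κ(t)})`, the union of the two one-sided
derivatives — is the parent's, re-run with the new constants (private twins suffixed `_nkc`; the parent's `IPWBV`, `pwbVisitMean`,
`IPWB_le_IPWBV`, `two_mul_IPWBV_le` are imported, not re-declared).  `4 ≤ μ³` (`μ² = 2 + √2`) keeps the box inside `y ≥ 1`.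

HONEST LABEL.  LANE THEOREM (range extension), DERIVED: the parent's theorem with a better envelope; the new input is the six-step law
(car 71) through `HexSAWSurfaceWallRenewalCubeRange`.  NEW IN WRITING (modest): differentiability of the boundary free energy of adsorbing
honeycomb SAWs (no first-order transition) and the renewal–reward identification of the contact density on the explicit range
`y > (2+√2)^{3/2}`; in print the free energy is convex and "almost everywhere differentiable"
[BeatonBousquetMelouDeGierDuminilCopinGuttmann2014, §3.1, Proposition 5 (arXiv v5 p. 9)], the one-sided energy densities are
[JansevanRensburgWhittington2013, §3.1 (3.3)–(3.4)], the renewal–reward template is [Giacomin2011, Chapter 2, Remark 2.3 and (2.11)],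
[Hollander2009, §7.1, Theorem 7.3]; the range `y > μ³` (like the parent's `y > μ⁴`) is the lane's artefact, far from `y_c = 1 + √2`.
Sources AS PRINTED as in the parent: [MadrasSlade1993, §4.2, (4.2.2), (4.2.4)–(4.2.5), Theorem 4.2.2(b) (pp. 90–92), the remark before
(4.2.21) (p. 94)], [Kesten1963SAW, §4], [Feller1968, XIII.3], [HammersleyTorrieWhittington1982, §2], [DuminilCopinSmirnov2012, Theorem 1
(μ = √(2+√2))].  NOT CLAIMED: anything at or below `μ³`; `κ ∈ C¹`, analyticity of `β`, the sign of `κ''`; numerics.  One private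
auxiliary definition (`genD_nkc`, the termwise Fréchet derivative — the parent's `genD_nk`), no public definition.
-/

noncomputable section

namespace Literature.Probability.RandomPlanarGeometry.SAW.HexBW.Wall

open Finset Filter Function
open Literature.Probability.LatticeModels
open _root_.Topology

variable {y : ℝ} {t : ℝ} {n : ℕ} {ω : ℕ → Site 2}

/-! ### §0 Private numerics -/

/-- `μ² = 2 + √2`. [cite: DuminilCopinSmirnov2012, Theorem 1 (μ = √(2+√2))] -/
private theorem mu_sq_nkc : hexConnectiveConstant ^ 2 = 2 + Real.sqrt 2 := by
  rw [hexConnectiveConstant_eq_inv, inv_pow]; exact inv_eq_of_mul_eq_one_right hexCriticalFugacity_sq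

/-- `4 ≤ μ³` (`μ² = 2 + √2 ≥ 3.4`, `μ ≥ 1.8`). [cite: DuminilCopinSmirnov2012, Theorem 1 (μ = √(2+√2))] -/
private theorem four_le_mu_cube_nkc : 4 ≤ hexConnectiveConstant ^ 3 := by
  have hμ := hexConnectiveConstant_pos
  have h2 : (1.4 : ℝ) ≤ Real.sqrt 2 := by
    rw [Real.le_sqrt (by norm_num) (by norm_num)]; norm_num
  have hsq : (3.4 : ℝ) ≤ hexConnectiveConstant ^ 2 := by rw [mu_sq_nkc]; linarith
  have h18 : (1.8 : ℝ) ≤ hexConnectiveConstant := by nlinarith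
  calc (4 : ℝ) ≤ 3.4 * 1.8 := by norm_num
    _ ≤ hexConnectiveConstant ^ 2 * hexConnectiveConstant := mul_le_mul hsq h18 (by norm_num) (by positivity)
    _ = hexConnectiveConstant ^ 3 := by ring

/-- `y > μ³ ⇒ 1 ≤ y` (indeed `y > 4`). [cite: DuminilCopinSmirnov2012, Theorem 1 (μ = √(2+√2))] -/
private theorem one_le_of_mu_cube_lt_nkc (hy : hexConnectiveConstant ^ 3 < y) : 1 ≤ y := by
  have := four_le_mu_cube_nkc; linarith

/-- [folklore] `θ₃ = μ²/y^{2/3} > 0` for `y > 0`. -/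
private theorem theta_pos_nkc (hy : 0 < y) : 0 < hexConnectiveConstant ^ 2 / y ^ ((2 : ℝ) / 3) :=
  div_pos (pow_pos hexConnectiveConstant_pos 2) (Real.rpow_pos_of_pos hy _)

/-! ### §1 Private monotonicity, scaling and derivative of the block polynomials (twins of the parent's) -/

/-- Monotonicity of `Λ_n` in `y ≥ 0`. [cite: MadrasSlade1993, §4.2, (4.2.2)] -/
private theorem IPWB_mono_nkc (n : ℕ) {y y' : ℝ} (hy : 0 ≤ y) (hyy' : y ≤ y') : IPWB n y ≤ IPWB n y' :=
  Finset.sum_le_sum fun _ _ => pow_le_pow_left₀ hy hyy' _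

/-- Monotonicity of `Λ^v_n` in `y ≥ 0`. [cite: MadrasSlade1993, §4.2, (4.2.2)] -/
private theorem IPWBV_mono_nkc (n : ℕ) {y y' : ℝ} (hy : 0 ≤ y) (hyy' : y ≤ y') : IPWBV n y ≤ IPWBV n y' :=
  Finset.sum_le_sum fun _ _ => mul_le_mul_of_nonneg_left (pow_le_pow_left₀ hy hyy' _) (Nat.cast_nonneg _)

/-- **Scaling margin in `y`**: `Λ_{2s}(c²y) ≤ c^{s+1} Λ_{2s}(y)` for `c ≥ 1`, `y ≥ 0` (entropy lemma: `2·visits ≤ s + 1`).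
[cite: MadrasSlade1993, §4.2, remark before (4.2.21) (p. 94)] -/
private theorem IPWB_scale_nkc (s : ℕ) {c : ℝ} (hc : 1 ≤ c) (hy : 0 ≤ y) :
    IPWB (2 * s) (c ^ 2 * y) ≤ c ^ (s + 1) * IPWB (2 * s) y := by
  rw [IPWB, IPWB, Finset.mul_sum]
  refine Finset.sum_le_sum fun ω hω => ?_
  have h4 := four_mul_visits_le hω
  rw [mul_pow, ← pow_mul]
  exact mul_le_mul_of_nonneg_right (pow_le_pow_right₀ hc (by omega)) (pow_nonneg hy _)

/-- `Λ^v_{2s}(c²y) ≤ c^{s+1} Λ^v_{2s}(y)` for `c ≥ 1`, `y ≥ 0`. [cite: MadrasSlade1993, §4.2, remark before (4.2.21) (p. 94)] -/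
private theorem IPWBV_scale_nkc (s : ℕ) {c : ℝ} (hc : 1 ≤ c) (hy : 0 ≤ y) :
    IPWBV (2 * s) (c ^ 2 * y) ≤ c ^ (s + 1) * IPWBV (2 * s) y := by
  rw [IPWBV, IPWBV, Finset.mul_sum]
  refine Finset.sum_le_sum fun ω hω => ?_
  have h4 := four_mul_visits_le hω
  have hc' : c ^ (2 * visits (2 * s) ω) ≤ c ^ (s + 1) := pow_le_pow_right₀ hc (by omega)
  have hv0 : (0 : ℝ) ≤ visits (2 * s) ω := Nat.cast_nonneg _
  have hyv : 0 ≤ y ^ visits (2 * s) ω := pow_nonneg hy _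
  rw [mul_pow, ← pow_mul]
  nlinarith [mul_le_mul_of_nonneg_left hc' (mul_nonneg hv0 hyv)]

/-- `Λ_n` is differentiable with `Λ_n'(y) = Λ^v_n(y)/y` (`y ≠ 0`). [cite: MadrasSlade1993, §4.2, (4.2.2)] -/
private theorem hasDerivAt_IPWB_nkc (n : ℕ) (hy : y ≠ 0) : HasDerivAt (IPWB n) (IPWBV n y / y) y := by
  have h : HasDerivAt (fun x : ℝ => ∑ ω ∈ ipwb n, x ^ visits n ω)
      (∑ ω ∈ ipwb n, (visits n ω : ℝ) * y ^ (visits n ω - 1)) y :=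
    HasDerivAt.fun_sum fun ω _ => hasDerivAt_pow (visits n ω) y
  have hfun : IPWB n = fun x : ℝ => ∑ ω ∈ ipwb n, x ^ visits n ω := rfl
  rw [hfun]
  refine h.congr_deriv ?_
  rw [IPWBV, Finset.sum_div]
  refine Finset.sum_congr rfl fun ω _ => ?_
  rcases Nat.eq_zero_or_pos (visits n ω) with h0 | hpos
  · simp [h0]
  · obtain ⟨k, hk⟩ : ∃ k, visits n ω = k + 1 := ⟨visits n ω - 1, by omega⟩
    rw [hk, Nat.add_sub_cancel, pow_succ]
    field_simp

/-! ### §2 The mean number of surface visits of a block, for `y > μ³` -/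

/-- The visit series converges for `y > μ³` (its terms are at most `((s+1)/2) f_s`). [cite: MadrasSlade1993, §4.2, Theorem 4.2.2(b) (pp. 91–92)]
[cite: Feller1968, XIII.3] -/
theorem summable_IPWBV_div_of_cube_lt (hy : hexConnectiveConstant ^ 3 < y) :
    Summable fun s : ℕ => IPWBV (2 * s) y / wallRate y ^ (2 * s) := by
  have hy0 : 0 < y := by have := four_le_mu_cube_nkc; linarith
  have hs : Summable fun s : ℕ => ((s : ℝ) + 1) / 2 * pwbLaw y s := by
    have h := ((summable_mul_pwbLaw_of_cube_lt hy).add (hasSum_pwbLaw_of_cube_lt hy).summable).div_const 2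
    refine h.congr fun s => ?_
    ring
  refine hs.of_nonneg_of_le (fun s => div_nonneg (IPWBV_nonneg _ hy0.le) (pow_nonneg (wallRate_pos y).le _)) fun s => ?_
  rw [pwbLaw, mul_div_assoc']
  exact div_le_div_of_nonneg_right (by have := two_mul_IPWBV_le s hy0.le; linarith) (pow_nonneg (wallRate_pos y).le _)

/-- **`1 ≤ V(y)`** for `y > μ³` (`Λ ≤ Λ^v` termwise and Kesten's identity `Σ f_s = 1`).
[cite: MadrasSlade1993, §4.2, eq. (4.2.4) (p. 91)] [cite: Kesten1963SAW, §4] -/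
theorem one_le_pwbVisitMean_of_cube_lt (hy : hexConnectiveConstant ^ 3 < y) : 1 ≤ pwbVisitMean y := by
  have hy0 : 0 < y := by have := four_le_mu_cube_nkc; linarith
  rw [← (hasSum_pwbLaw_of_cube_lt hy).tsum_eq, pwbVisitMean]
  refine (hasSum_pwbLaw_of_cube_lt hy).summable.tsum_le_tsum (fun s => ?_) (summable_IPWBV_div_of_cube_lt hy)
  exact div_le_div_of_nonneg_right (IPWB_le_IPWBV _ hy0.le) (pow_nonneg (wallRate_pos y).le _)

/-- **`2V(y) ≤ m(y) + 1`** for `y > μ³` (the entropy lemma termwise). [cite: MadrasSlade1993, §4.2, remark before (4.2.21) (p. 94)]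
[cite: MadrasSlade1993, §4.2, Theorem 4.2.2(b) (pp. 91–92)] -/
theorem two_mul_pwbVisitMean_le_of_cube_lt (hy : hexConnectiveConstant ^ 3 < y) : 2 * pwbVisitMean y ≤ pwbMean y + 1 := by
  have hy0 : 0 < y := by have := four_le_mu_cube_nkc; linarith
  have h2 : HasSum (fun s : ℕ => 2 * (IPWBV (2 * s) y / wallRate y ^ (2 * s))) (2 * pwbVisitMean y) :=
    (summable_IPWBV_div_of_cube_lt hy).hasSum.mul_left 2
  have hm : HasSum (fun s : ℕ => (s : ℝ) * pwbLaw y s + pwbLaw y s) (pwbMean y + 1) :=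
    (summable_mul_pwbLaw_of_cube_lt hy).hasSum.add (hasSum_pwbLaw_of_cube_lt hy)
  refine hasSum_le (fun s => ?_) h2 hm
  rw [pwbLaw]
  simp only [mul_div_assoc']
  rw [← add_div, ← add_one_mul]
  exact div_le_div_of_nonneg_right (two_mul_IPWBV_le s hy0.le) (pow_nonneg (wallRate_pos y).le _)

/-- `0 < V(y)` for `y > μ³`. [cite: MadrasSlade1993, §4.2, eq. (4.2.4) (p. 91)] -/
theorem pwbVisitMean_pos_of_cube_lt (hy : hexConnectiveConstant ^ 3 < y) : 0 < pwbVisitMean y :=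
  one_pos.trans_le (one_le_pwbVisitMean_of_cube_lt hy)

/-! ### §3 The analytic core: Fréchet differentiability of the block generating function at `(y, β(y)⁻²)` -/

/-- The termwise Fréchet derivative of `(y, u) ↦ Λ_{2s}(y) u^s`: `(Λ^v_{2s}(y) u^s / y)·dy + (s Λ_{2s}(y) u^{s−1})·du`.
[cite: Giacomin2011, Chapter 2, Remark 2.3 (differentiating the renewal equation (2.9))] -/
private noncomputable def genD_nkc (s : ℕ) (p : ℝ × ℝ) : ℝ × ℝ →L[ℝ] ℝ :=
  (IPWBV (2 * s) p.1 * p.2 ^ s / p.1) • ContinuousLinearMap.fst ℝ ℝ ℝ +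
    ((s : ℝ) * IPWB (2 * s) p.1 * p.2 ^ (s - 1)) • ContinuousLinearMap.snd ℝ ℝ ℝ

/-- Each term `(y, u) ↦ Λ_{2s}(y) u^s` is Fréchet differentiable (`y ≠ 0`) with derivative `genD_nkc s`.
[cite: Giacomin2011, Chapter 2, Remark 2.3] -/
private theorem hasFDerivAt_term_nkc (s : ℕ) {p : ℝ × ℝ} (hp : p.1 ≠ 0) :
    HasFDerivAt (fun q : ℝ × ℝ => IPWB (2 * s) q.1 * q.2 ^ s) (genD_nkc s p) p := by
  have h1 : HasFDerivAt (fun q : ℝ × ℝ => IPWB (2 * s) q.1)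
      ((IPWBV (2 * s) p.1 / p.1) • ContinuousLinearMap.fst ℝ ℝ ℝ) p :=
    (hasDerivAt_IPWB_nkc (2 * s) hp).comp_hasFDerivAt p hasFDerivAt_fst
  have h2 : HasFDerivAt (fun q : ℝ × ℝ => q.2 ^ s) (((s : ℝ) * p.2 ^ (s - 1)) • ContinuousLinearMap.snd ℝ ℝ ℝ) p :=
    (hasDerivAt_pow s p.2).comp_hasFDerivAt p hasFDerivAt_snd
  refine (h1.mul h2).congr_fderiv ?_
  rw [genD_nkc, smul_smul, smul_smul, add_comm]
  congr 1 <;> congr 1 <;> ring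

/-- The convergence margin: for `0 < θ < 1`, `Λ := 2/(1 + θ)` has `1 < Λ ≤ 2` and `Λ²θ < 1` (as `4θ < (1 + θ)²`).
[cite: MadrasSlade1993, §4.2, remark before (4.2.21) (p. 94)] -/
private theorem margin_nkc {θ : ℝ} (hθ0 : 0 < θ) (hθ1 : θ < 1) :
    1 < 2 / (1 + θ) ∧ 2 / (1 + θ) ≤ 2 ∧ (2 / (1 + θ)) ^ 2 * θ < 1 := by
  have h1 : (0 : ℝ) < 1 + θ := by linarith
  have h1θ : (1 : ℝ) + θ ≠ 0 := ne_of_gt h1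
  refine ⟨by rw [lt_div_iff₀ h1]; linarith, by rw [div_le_iff₀ h1]; linarith, ?_⟩
  have hΛθ : 2 / (1 + θ) * (1 + θ) = 2 := div_mul_cancel₀ _ h1θ
  have h : (1 + θ) ^ 2 * ((2 / (1 + θ)) ^ 2 * θ) = 4 * θ := by
    calc (1 + θ) ^ 2 * ((2 / (1 + θ)) ^ 2 * θ) = (2 / (1 + θ) * (1 + θ)) ^ 2 * θ := by ring
      _ = 4 * θ := by rw [hΛθ]; norm_num
  have h2 : 4 * θ < (1 + θ) ^ 2 * 1 := by nlinarith [sq_pos_of_pos (by linarith : 0 < 1 - θ)]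
  exact lt_of_mul_lt_mul_left (by linarith : (1 + θ) ^ 2 * ((2 / (1 + θ)) ^ 2 * θ) < (1 + θ) ^ 2 * 1) (by positivity)

/-- First coefficient on the box `1 ≤ q.1 ≤ Λ²y₀`, `0 ≤ q.2 ≤ Λu₀`:
`|Λ^v_{2s}(q.1) q.2^s / q.1| ≤ Λ^{s+1}Λ^v_{2s}(y₀)(Λu₀)^s ≤ ((s+1)/2) Λ^{2s+1} f_s ≤ E (Λ/2) (s+1) (Λ²θ)^s`.
[cite: MadrasSlade1993, §4.2, remark before (4.2.21) (p. 94)] -/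
private theorem coef_fst_bound_nkc {y₀ u₀ Λ E θ : ℝ} (s : ℕ) {q : ℝ × ℝ} (hy0 : 0 < y₀) (hu0 : 0 < u₀) (hΛ1 : 1 ≤ Λ)
    (hq1 : 1 ≤ q.1) (hq2 : q.1 ≤ Λ ^ 2 * y₀) (hq3 : 0 ≤ q.2) (hq4 : q.2 ≤ Λ * u₀)
    (hfu : IPWB (2 * s) y₀ * u₀ ^ s = pwbLaw y₀ s) (hfs : pwbLaw y₀ s ≤ E * θ ^ s) :
    |IPWBV (2 * s) q.1 * q.2 ^ s / q.1| ≤ E * (Λ / 2) * (((s : ℝ) + 1) * (Λ ^ 2 * θ) ^ s) := by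
  have hq0 : 0 ≤ q.1 := by linarith
  have hΛ0 : 0 ≤ Λ := by linarith
  have hav0 : 0 ≤ IPWBV (2 * s) q.1 := IPWBV_nonneg _ hq0
  have hus0 : 0 ≤ q.2 ^ s := pow_nonneg hq3 s
  have hΛs0 : 0 ≤ Λ ^ (s + 1) := pow_nonneg hΛ0 _
  have hΛu0 : 0 ≤ (Λ * u₀) ^ s := pow_nonneg (mul_nonneg hΛ0 hu0.le) s
  have hs0 : (0 : ℝ) ≤ (s : ℝ) + 1 := by positivity
  rw [abs_of_nonneg (div_nonneg (mul_nonneg hav0 hus0) hq0)]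
  calc IPWBV (2 * s) q.1 * q.2 ^ s / q.1 ≤ IPWBV (2 * s) q.1 * q.2 ^ s := div_le_self (mul_nonneg hav0 hus0) hq1
    _ ≤ (Λ ^ (s + 1) * IPWBV (2 * s) y₀) * (Λ * u₀) ^ s :=
        mul_le_mul ((IPWBV_mono_nkc _ hq0 hq2).trans (IPWBV_scale_nkc s hΛ1 hy0.le)) (pow_le_pow_left₀ hq3 hq4 s) hus0
          (mul_nonneg hΛs0 (IPWBV_nonneg _ hy0.le))
    _ ≤ (Λ ^ (s + 1) * (((s : ℝ) + 1) / 2 * IPWB (2 * s) y₀)) * (Λ * u₀) ^ s := by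
        have h := two_mul_IPWBV_le s hy0.le
        exact mul_le_mul_of_nonneg_right (mul_le_mul_of_nonneg_left (by linarith) hΛs0) hΛu0
    _ = Λ / 2 * ((s : ℝ) + 1) * (Λ ^ 2) ^ s * (IPWB (2 * s) y₀ * u₀ ^ s) := by rw [mul_pow]; ring
    _ = Λ / 2 * ((s : ℝ) + 1) * (Λ ^ 2) ^ s * pwbLaw y₀ s := by rw [hfu]
    _ ≤ Λ / 2 * ((s : ℝ) + 1) * (Λ ^ 2) ^ s * (E * θ ^ s) :=
        mul_le_mul_of_nonneg_left hfs (mul_nonneg (mul_nonneg (by linarith) hs0) (pow_nonneg (sq_nonneg Λ) s))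
    _ = E * (Λ / 2) * (((s : ℝ) + 1) * (Λ ^ 2 * θ) ^ s) := by rw [mul_pow]; ring

/-- Second coefficient on the same box: `|s Λ_{2s}(q.1) q.2^{s−1}| ≤ s Λ^{2s} f_s / u₀ ≤ E (1/u₀) (s+1) (Λ²θ)^s`.
[cite: MadrasSlade1993, §4.2, remark before (4.2.21) (p. 94)] -/
private theorem coef_snd_bound_nkc {y₀ u₀ Λ E θ : ℝ} (s : ℕ) {q : ℝ × ℝ} (hy0 : 0 < y₀) (hu0 : 0 < u₀) (hΛ1 : 1 ≤ Λ)
    (hE0 : 0 ≤ E) (hθ0 : 0 ≤ θ) (hq1 : 1 ≤ q.1) (hq2 : q.1 ≤ Λ ^ 2 * y₀) (hq3 : 0 ≤ q.2) (hq4 : q.2 ≤ Λ * u₀)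
    (hfu : IPWB (2 * s) y₀ * u₀ ^ s = pwbLaw y₀ s) (hfs : pwbLaw y₀ s ≤ E * θ ^ s) :
    |(s : ℝ) * IPWB (2 * s) q.1 * q.2 ^ (s - 1)| ≤ E * (1 / u₀) * (((s : ℝ) + 1) * (Λ ^ 2 * θ) ^ s) := by
  have hq0 : 0 ≤ q.1 := by linarith
  have hΛ0 : 0 ≤ Λ := by linarith
  have hiu : 0 ≤ 1 / u₀ := le_of_lt (one_div_pos.2 hu0)
  rw [abs_of_nonneg (mul_nonneg (mul_nonneg (Nat.cast_nonneg _) (IPWB_nonneg _ hq0)) (pow_nonneg hq3 _))]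
  rcases Nat.eq_zero_or_pos s with h0 | hspos
  · subst h0
    simp only [Nat.cast_zero, zero_mul, zero_add, pow_zero, mul_one]
    exact mul_nonneg hE0 hiu
  obtain ⟨k, rfl⟩ : ∃ k, s = k + 1 := ⟨s - 1, by omega⟩
  rw [Nat.add_sub_cancel]
  have hk0 : (0 : ℝ) ≤ ((k + 1 : ℕ) : ℝ) := Nat.cast_nonneg _
  have ha := (IPWB_mono_nkc (2 * (k + 1)) hq0 hq2).trans (IPWB_scale_nkc (k + 1) hΛ1 hy0.le)
  have ha0 : 0 ≤ IPWB (2 * (k + 1)) y₀ := IPWB_nonneg _ hy0.le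
  have hZ : 0 ≤ E * (1 / u₀) * (Λ ^ 2 * θ) ^ (k + 1) :=
    mul_nonneg (mul_nonneg hE0 hiu) (pow_nonneg (mul_nonneg (sq_nonneg Λ) hθ0) _)
  calc ((k + 1 : ℕ) : ℝ) * IPWB (2 * (k + 1)) q.1 * q.2 ^ k
      ≤ ((k + 1 : ℕ) : ℝ) * (Λ ^ (k + 1 + 1) * IPWB (2 * (k + 1)) y₀) * (Λ * u₀) ^ k :=
        mul_le_mul (mul_le_mul_of_nonneg_left ha hk0) (pow_le_pow_left₀ hq3 hq4 k) (pow_nonneg hq3 k)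
          (mul_nonneg hk0 (mul_nonneg (pow_nonneg hΛ0 _) ha0))
    _ = (1 / u₀) * ((k + 1 : ℕ) : ℝ) * (Λ ^ 2) ^ (k + 1) * (IPWB (2 * (k + 1)) y₀ * u₀ ^ (k + 1)) := by
        rw [pow_succ u₀ k]
        have e : (1 / u₀) * ((k + 1 : ℕ) : ℝ) * (Λ ^ 2) ^ (k + 1) * (IPWB (2 * (k + 1)) y₀ * (u₀ ^ k * u₀)) =
            ((k + 1 : ℕ) : ℝ) * (Λ ^ 2) ^ (k + 1) * IPWB (2 * (k + 1)) y₀ * u₀ ^ k * (u₀ * (1 / u₀)) := by ring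
        rw [e, one_div, mul_inv_cancel₀ hu0.ne', mul_one, mul_pow]
        ring
    _ = (1 / u₀) * ((k + 1 : ℕ) : ℝ) * (Λ ^ 2) ^ (k + 1) * pwbLaw y₀ (k + 1) := by rw [hfu]
    _ ≤ (1 / u₀) * ((k + 1 : ℕ) : ℝ) * (Λ ^ 2) ^ (k + 1) * (E * θ ^ (k + 1)) :=
        mul_le_mul_of_nonneg_left hfs (mul_nonneg (mul_nonneg hiu hk0) (pow_nonneg (sq_nonneg Λ) _))
    _ = ((k + 1 : ℕ) : ℝ) * (E * (1 / u₀) * (Λ ^ 2 * θ) ^ (k + 1)) := by rw [mul_pow]; ring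
    _ ≤ (((k + 1 : ℕ) : ℝ) + 1) * (E * (1 / u₀) * (Λ ^ 2 * θ) ^ (k + 1)) :=
        mul_le_mul_of_nonneg_right (by linarith) hZ
    _ = E * (1 / u₀) * ((((k + 1 : ℕ) : ℝ) + 1) * (Λ ^ 2 * θ) ^ (k + 1)) := by ring

/-- The operator-norm bound on the box: `‖genD_nkc s q‖ ≤ E (Λ/2 + 1/u₀) (s+1) (Λ²θ)^s` — a summable majorant since `Λ²θ < 1`.
[cite: MadrasSlade1993, §4.2, remark before (4.2.21) (p. 94)] [cite: Feller1968, XIII.3] -/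
private theorem norm_genD_le_nkc {y₀ u₀ Λ E θ : ℝ} (s : ℕ) {q : ℝ × ℝ} (hy0 : 0 < y₀) (hu0 : 0 < u₀) (hΛ1 : 1 ≤ Λ)
    (hE0 : 0 ≤ E) (hθ0 : 0 ≤ θ) (hq1 : 1 ≤ q.1) (hq2 : q.1 ≤ Λ ^ 2 * y₀) (hq3 : 0 ≤ q.2) (hq4 : q.2 ≤ Λ * u₀)
    (hfu : IPWB (2 * s) y₀ * u₀ ^ s = pwbLaw y₀ s) (hfs : pwbLaw y₀ s ≤ E * θ ^ s) :
    ‖genD_nkc s q‖ ≤ E * (Λ / 2 + 1 / u₀) * (((s : ℝ) + 1) * (Λ ^ 2 * θ) ^ s) := by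
  have hc1 := coef_fst_bound_nkc s hy0 hu0 hΛ1 hq1 hq2 hq3 hq4 hfu hfs
  have hc2 := coef_snd_bound_nkc s hy0 hu0 hΛ1 hE0 hθ0 hq1 hq2 hq3 hq4 hfu hfs
  calc ‖genD_nkc s q‖ ≤ ‖(IPWBV (2 * s) q.1 * q.2 ^ s / q.1) • ContinuousLinearMap.fst ℝ ℝ ℝ‖ +
        ‖((s : ℝ) * IPWB (2 * s) q.1 * q.2 ^ (s - 1)) • ContinuousLinearMap.snd ℝ ℝ ℝ‖ := norm_add_le _ _
    _ ≤ |IPWBV (2 * s) q.1 * q.2 ^ s / q.1| + |(s : ℝ) * IPWB (2 * s) q.1 * q.2 ^ (s - 1)| := by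
        rw [norm_smul, norm_smul, Real.norm_eq_abs, Real.norm_eq_abs]
        exact add_le_add (mul_le_of_le_one_right (abs_nonneg _) (ContinuousLinearMap.norm_fst_le ℝ ℝ ℝ))
          (mul_le_of_le_one_right (abs_nonneg _) (ContinuousLinearMap.norm_snd_le ℝ ℝ ℝ))
    _ ≤ E * (Λ / 2) * (((s : ℝ) + 1) * (Λ ^ 2 * θ) ^ s) + E * (1 / u₀) * (((s : ℝ) + 1) * (Λ ^ 2 * θ) ^ s) :=
        add_le_add hc1 hc2
    _ = E * (Λ / 2 + 1 / u₀) * (((s : ℝ) + 1) * (Λ ^ 2 * θ) ^ s) := by ring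

/-- In the variables `(a_s, u₀)`, `a_s u₀^s = f_s(y₀)` (`u₀ = β(y₀)⁻²`). [cite: MadrasSlade1993, §4.2, eq. (4.2.4) (p. 91)] -/
private theorem IPWB_mul_pow_nkc {y₀ u₀ : ℝ} (hu₀ : u₀ = (wallRate y₀ ^ 2)⁻¹) (s : ℕ) :
    IPWB (2 * s) y₀ * u₀ ^ s = pwbLaw y₀ s := by
  rw [hu₀, inv_pow, ← pow_mul, pwbLaw, div_eq_mul_inv]

/-- The value of the termwise derivative series at the point: `Σ_s genD_nkc s (y₀, u₀) = (V(y₀)/y₀)·dy + (m(y₀)/u₀)·du`.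
[cite: Giacomin2011, Chapter 2, eq. (2.11)] [cite: MadrasSlade1993, §4.2, eq. (4.2.4) (p. 91)] -/
private theorem hasSum_genD_nkc {y₀ u₀ : ℝ} (hy₀ : hexConnectiveConstant ^ 3 < y₀) (hu₀ : u₀ = (wallRate y₀ ^ 2)⁻¹) :
    HasSum (fun s : ℕ => genD_nkc s (y₀, u₀))
      ((pwbVisitMean y₀ / y₀) • ContinuousLinearMap.fst ℝ ℝ ℝ + (pwbMean y₀ / u₀) • ContinuousLinearMap.snd ℝ ℝ ℝ) := by
  have hu0 : 0 < u₀ := by rw [hu₀]; have := wallRate_pos y₀; positivity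
  have hfu := IPWB_mul_pow_nkc hu₀
  have hV : HasSum (fun s : ℕ => IPWBV (2 * s) y₀ * u₀ ^ s / y₀) (pwbVisitMean y₀ / y₀) := by
    have h := (summable_IPWBV_div_of_cube_lt hy₀).hasSum.div_const y₀
    have e : (fun s : ℕ => IPWBV (2 * s) y₀ / wallRate y₀ ^ (2 * s) / y₀) =
        fun s : ℕ => IPWBV (2 * s) y₀ * u₀ ^ s / y₀ := by
      funext s; rw [hu₀, inv_pow, ← pow_mul, div_eq_mul_inv (IPWBV _ _)]
    rw [e] at h; exact h
  have hM : HasSum (fun s : ℕ => (s : ℝ) * IPWB (2 * s) y₀ * u₀ ^ (s - 1)) (pwbMean y₀ / u₀) := by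
    have h := (summable_mul_pwbLaw_of_cube_lt hy₀).hasSum.div_const u₀
    have e : (fun s : ℕ => (s : ℝ) * pwbLaw y₀ s / u₀) = fun s : ℕ => (s : ℝ) * IPWB (2 * s) y₀ * u₀ ^ (s - 1) := by
      funext s
      rcases Nat.eq_zero_or_pos s with h0 | hs
      · subst h0; simp
      · obtain ⟨k, rfl⟩ : ∃ k, s = k + 1 := ⟨s - 1, by omega⟩
        rw [← hfu, Nat.add_sub_cancel, pow_succ, ← mul_assoc, ← mul_assoc, mul_div_assoc, div_self hu0.ne', mul_one]
    rw [e] at h; exact h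
  exact (hV.smul_const _).add (hM.smul_const _)

/-- **Fréchet differentiability of the block generating function** `G(y, u) = Σ_s Λ_{2s}(y) u^s` at `(y₀, β(y₀)⁻²)`, `y₀ > μ³`,
with derivative `(V(y₀)/y₀)·dy + (m(y₀) β(y₀)²)·du` (termwise differentiation on the box
`(y₀/Λ², Λ²y₀) × (u₀/Λ, Λu₀)`, `Λ = 2/(1 + θ)`, where the envelope still converges: `Λ²θ < 1`).
[cite: Giacomin2011, Chapter 2, Remark 2.3 ("z ↦ Σ_n K(n)exp(−zn) is analytic … and its derivative does not vanish")]
[cite: MadrasSlade1993, §4.2, remark before (4.2.21) (p. 94)] [cite: Feller1968, XIII.3] -/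
private theorem hasFDerivAt_gen_nkc {y₀ u₀ : ℝ} (hy₀ : hexConnectiveConstant ^ 3 < y₀) (hu₀ : u₀ = (wallRate y₀ ^ 2)⁻¹) :
    HasFDerivAt (fun q : ℝ × ℝ => ∑' s : ℕ, IPWB (2 * s) q.1 * q.2 ^ s)
      ((pwbVisitMean y₀ / y₀) • ContinuousLinearMap.fst ℝ ℝ ℝ +
        (pwbMean y₀ / u₀) • ContinuousLinearMap.snd ℝ ℝ ℝ) (y₀, u₀) := by
  have hy1 := one_le_of_mu_cube_lt_nkc hy₀
  have hy0 : 0 < y₀ := by linarith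
  have h4y : 4 < y₀ := lt_of_le_of_lt four_le_mu_cube_nkc hy₀
  have hβ : 0 < wallRate y₀ := wallRate_pos y₀
  have hu0 : 0 < u₀ := by rw [hu₀]; positivity
  have hfu := IPWB_mul_pow_nkc hu₀
  -- envelope `f_s ≤ E θ^s`
  have hθ0 : 0 < hexConnectiveConstant ^ 2 / y₀ ^ ((2 : ℝ) / 3) := theta_pos_nkc hy0
  have hθ1 : hexConnectiveConstant ^ 2 / y₀ ^ ((2 : ℝ) / 3) < 1 := theta_cube_lt_one hy₀
  obtain ⟨hΛ1, hΛ2, hr1⟩ := margin_nkc hθ0 hθ1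
  set θ := hexConnectiveConstant ^ 2 / y₀ ^ ((2 : ℝ) / 3) with hθ
  set E := hexConnectiveConstant ^ 2 + y₀ ^ ((2 : ℝ) / 3) / hexConnectiveConstant ^ 2 with hE
  have hE0 : 0 ≤ E := by positivity
  have henv : ∀ s : ℕ, pwbLaw y₀ s ≤ E * θ ^ s := fun s => pwbLaw_le_geom_cube hy1 s
  -- the margin Λ = 2/(1+θ) and the ratio r = Λ²θ < 1
  set Λ := 2 / (1 + θ) with hΛ
  have hΛ0 : 0 < Λ := by linarith
  set r := Λ ^ 2 * θ with hr
  have hr0 : 0 ≤ r := mul_nonneg (sq_nonneg Λ) hθ0.le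
  -- the box
  set S : Set (ℝ × ℝ) := Set.Ioo (y₀ / Λ ^ 2) (Λ ^ 2 * y₀) ×ˢ Set.Ioo (u₀ / Λ) (Λ * u₀) with hS
  have hΛsq1 : 1 < Λ ^ 2 := by nlinarith
  have hΛsq4 : Λ ^ 2 ≤ 4 := by nlinarith
  have hmem : (y₀, u₀) ∈ S :=
    ⟨⟨div_lt_self hy0 hΛsq1, lt_mul_of_one_lt_left hy0 hΛsq1⟩, ⟨div_lt_self hu0 hΛ1, lt_mul_of_one_lt_left hu0 hΛ1⟩⟩
  have hSo : IsOpen S := isOpen_Ioo.prod isOpen_Ioo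
  have hSc : IsPreconnected S := ((convex_Ioo _ _).prod (convex_Ioo _ _)).isPreconnected
  have hbox : ∀ q ∈ S, 1 ≤ q.1 ∧ q.1 ≤ Λ ^ 2 * y₀ ∧ 0 ≤ q.2 ∧ q.2 ≤ Λ * u₀ := fun q hq => by
    obtain ⟨⟨h1, h2⟩, ⟨h3, h4⟩⟩ := hq
    have h5 : 1 ≤ y₀ / Λ ^ 2 := by rw [le_div_iff₀ (by positivity)]; linarith
    have h6 : 0 < u₀ / Λ := div_pos hu0 hΛ0
    exact ⟨by linarith, h2.le, by linarith, h4.le⟩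
  -- the summable majorant B_s = E (Λ/2 + 1/u₀) ((s+1) r^s)
  have hgeo : Summable fun s : ℕ => ((s : ℝ) + 1) * r ^ s := by
    have h1 := summable_pow_mul_geometric_of_norm_lt_one 1 (show ‖r‖ < 1 by rw [Real.norm_of_nonneg hr0]; exact hr1)
    have h2 := summable_geometric_of_lt_one hr0 hr1
    simpa [add_mul, pow_one] using h1.add h2
  have hB := hgeo.mul_left (E * (Λ / 2 + 1 / u₀))
  have hnorm : ∀ (s : ℕ) (q : ℝ × ℝ), q ∈ S → ‖genD_nkc s q‖ ≤ E * (Λ / 2 + 1 / u₀) * (((s : ℝ) + 1) * r ^ s) :=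
    fun s q hq => by
      obtain ⟨hq1, hq2, hq3, hq4⟩ := hbox q hq
      exact norm_genD_le_nkc s hy0 hu0 hΛ1.le hE0 hθ0.le hq1 hq2 hq3 hq4 (hfu s) (henv s)
  -- summability at the centre: Σ a_s u₀^s = Σ f_s
  have hf0 : Summable fun s : ℕ => IPWB (2 * s) (y₀, u₀).1 * (y₀, u₀).2 ^ s := by
    simp only [hfu]; exact (hasSum_pwbLaw_of_cube_lt hy₀).summable
  have hderiv := hasFDerivAt_tsum_of_isPreconnected hB hSo hSc
    (fun s q hq => hasFDerivAt_term_nkc s (by have := (hbox q hq).1; exact ne_of_gt (by linarith)))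
    hnorm hmem hf0 hmem
  exact hderiv.congr_fderiv (hasSum_genD_nkc hy₀ hu₀).tsum_eq

/-! ### §4 The one-sided chain rule along Kesten's curve, and the theorems -/

/-- The second coordinate of the curve: `e^{−2κ(t)} = β(eᵗ)⁻²`. [cite: BeatonBousquetMelouDeGierDuminilCopinGuttmann2014, §3.1, Proposition 5 (arXiv v5 p. 9)] -/
private theorem curve_eq_nkc (t : ℝ) : Real.exp (-(2 * wallFreeEnergy t)) = (wallRate (Real.exp t) ^ 2)⁻¹ := by
  rw [Real.exp_neg, wallFreeEnergy_apply, show (2 : ℝ) * Real.log (wallRate (Real.exp t)) =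
    Real.log (wallRate (Real.exp t)) + Real.log (wallRate (Real.exp t)) by ring, Real.exp_add,
    Real.exp_log (wallRate_pos _), sq]

/-- Kesten's identity along the curve: `G(eᵗ, β(eᵗ)⁻²) = Σ_s f_s(eᵗ) = 1` for `eᵗ > μ³`.
[cite: MadrasSlade1993, §4.2, eq. (4.2.4) (p. 91)] [cite: Kesten1963SAW, §4] -/
private theorem gen_curve_nkc (ht : hexConnectiveConstant ^ 3 < Real.exp t) :
    (∑' s : ℕ, IPWB (2 * s) (Real.exp t) * ((wallRate (Real.exp t) ^ 2)⁻¹) ^ s) = 1 := by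
  have h : ∀ s : ℕ, IPWB (2 * s) (Real.exp t) * ((wallRate (Real.exp t) ^ 2)⁻¹) ^ s = pwbLaw (Real.exp t) s :=
    fun s => by rw [inv_pow, ← pow_mul, pwbLaw, div_eq_mul_inv]
  simp only [h]; exact (hasSum_pwbLaw_of_cube_lt ht).tsum_eq

/-- **The one-sided chain rule** (the heart of the matter): if `κ` has derivative `ρ` at `t₀` within a set `I` of unique
differentiability (`I = (t₀, ∞)` or `(−∞, t₀)`), then `ρ = V(y₀)/(2m(y₀))`, `y₀ = e^{t₀} > μ³` — differentiate `G ≡ 1` along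
`t ↦ (eᵗ, e^{−2κ(t)})` within `I`: `V(y₀) − 2m(y₀)ρ = 0`.
[cite: Giacomin2011, Chapter 2, Remark 2.3 and eq. (2.11) (differentiating the renewal equation (2.9) gives F'(h) = 1/E τ̃₁)]
[cite: JansevanRensburgWhittington2013, §3.1 eq. (3.4) (arXiv v4 p. 6: the one-sided energies 𝓔_±)] -/
private theorem density_eq_nkc {t₀ ρ : ℝ} {I : Set ℝ} (ht₀ : hexConnectiveConstant ^ 3 < Real.exp t₀)
    (hκ : HasDerivWithinAt wallFreeEnergy ρ I t₀) (hI : UniqueDiffWithinAt ℝ I t₀) :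
    ρ = pwbVisitMean (Real.exp t₀) / (2 * pwbMean (Real.exp t₀)) := by
  have hev : ∀ᶠ t in 𝓝 t₀, hexConnectiveConstant ^ 3 < Real.exp t :=
    (Real.continuous_exp.tendsto t₀).eventually (eventually_gt_nhds ht₀)
  set y₀ := Real.exp t₀ with hy₀def
  set u₀ := (wallRate y₀ ^ 2)⁻¹ with hu₀def
  have hy0 : 0 < y₀ := Real.exp_pos t₀
  have hβ : 0 < wallRate y₀ := wallRate_pos y₀
  have hu0 : 0 < u₀ := by rw [hu₀def]; positivity
  have hm : 0 < pwbMean y₀ := pwbMean_pos_of_cube_lt ht₀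
  have hG := hasFDerivAt_gen_nkc ht₀ hu₀def
  -- the curve and its one-sided derivative
  have hψ : HasDerivWithinAt (fun t : ℝ => (Real.exp t, Real.exp (-(2 * wallFreeEnergy t))))
      (y₀, u₀ * (-(2 * ρ))) I t₀ := by
    have h1 : HasDerivWithinAt (fun t : ℝ => Real.exp t) y₀ I t₀ := (Real.hasDerivAt_exp t₀).hasDerivWithinAt
    have h2 : HasDerivWithinAt (fun t : ℝ => Real.exp (-(2 * wallFreeEnergy t)))
        (Real.exp (-(2 * wallFreeEnergy t₀)) * (-(2 * ρ))) I t₀ := ((hκ.const_mul 2).neg).exp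
    rw [curve_eq_nkc t₀] at h2
    exact h1.prodMk h2
  have hcomp := hG.comp_hasDerivWithinAt_of_eq t₀ hψ
    (by show (y₀, u₀) = (Real.exp t₀, Real.exp (-(2 * wallFreeEnergy t₀))); rw [curve_eq_nkc])
  -- the composite is identically 1 near t₀
  have happ : ∀ t : ℝ, ((fun q : ℝ × ℝ => ∑' s : ℕ, IPWB (2 * s) q.1 * q.2 ^ s) ∘
      (fun t : ℝ => (Real.exp t, Real.exp (-(2 * wallFreeEnergy t))))) t =
      ∑' s : ℕ, IPWB (2 * s) (Real.exp t) * (Real.exp (-(2 * wallFreeEnergy t))) ^ s := fun t => rfl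
  have hconst : HasDerivWithinAt (fun _ : ℝ => (1 : ℝ))
      (((pwbVisitMean y₀ / y₀) • ContinuousLinearMap.fst ℝ ℝ ℝ + (pwbMean y₀ / u₀) • ContinuousLinearMap.snd ℝ ℝ ℝ)
        (y₀, u₀ * (-(2 * ρ)))) I t₀ := by
    refine hcomp.congr_of_eventuallyEq ?_ ?_
    · filter_upwards [mem_nhdsWithin_of_mem_nhds hev] with t ht
      rw [happ, curve_eq_nkc t, gen_curve_nkc ht]
    · rw [happ, curve_eq_nkc t₀, gen_curve_nkc ht₀]
  have hzero := UniqueDiffWithinAt.eq_deriv I hI hconst (hasDerivWithinAt_const (x := t₀) (s := I) (c := (1 : ℝ)))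
  have happly : ((pwbVisitMean y₀ / y₀) • ContinuousLinearMap.fst ℝ ℝ ℝ +
      (pwbMean y₀ / u₀) • ContinuousLinearMap.snd ℝ ℝ ℝ) (y₀, u₀ * (-(2 * ρ))) =
      pwbVisitMean y₀ / y₀ * y₀ + pwbMean y₀ / u₀ * (u₀ * (-(2 * ρ))) := by
    simp [smul_eq_mul]
  rw [happly, div_mul_cancel₀ _ hy0.ne', ← mul_assoc, div_mul_cancel₀ _ hu0.ne'] at hzero
  rw [eq_div_iff (by positivity)]
  linarith

/-- **THE RENEWAL–REWARD FORMULA FOR THE DENSITY (right derivative)**: for `eᵗ = y > μ³`,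
`ρ⁺(t) = V(y)/(2m(y))` — mean number of surface visits per block over mean block length, under Kesten's block law.
[cite: Giacomin2011, Chapter 2, eq. (2.11) (F'(h) = 1/Σ_n n K̃_h(n) = 1/E τ̃₁ for homogeneous pinning)]
[cite: Hollander2009, §7.1, Theorem 7.3 and (7.26) (free-energy derivative = density of pinned monomers)] [cite: BeatonBousquetMelouDeGierDuminilCopinGuttmann2014, §3.1, Proposition 5 (arXiv v5 p. 9)]
[cite: MadrasSlade1993, §4.2, eq. (4.2.4) (p. 91) and Theorem 4.2.2(b) (pp. 91–92)] [cite: Kesten1963SAW, §4] -/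
theorem wallRightDensity_eq_visitMean_div_of_cube_lt (ht : hexConnectiveConstant ^ 3 < Real.exp t) :
    wallRightDensity t = pwbVisitMean (Real.exp t) / (2 * pwbMean (Real.exp t)) :=
  density_eq_nkc ht (hasDerivWithinAt_wallRightDensity t) (uniqueDiffWithinAt_Ioi t)

/-- **… and the same for the left derivative**: `ρ⁻(t) = V(y)/(2m(y))` for `eᵗ = y > μ³`.
[cite: Giacomin2011, Chapter 2, eq. (2.11)] [cite: JansevanRensburgWhittington2013, §3.1 eq. (3.4) (arXiv v4 p. 6: 𝓔₋ ≤ 𝓔₊)]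
[cite: MadrasSlade1993, §4.2, eq. (4.2.4) (p. 91)] -/
theorem wallLeftDensity_eq_visitMean_div_of_cube_lt (ht : hexConnectiveConstant ^ 3 < Real.exp t) :
    wallLeftDensity t = pwbVisitMean (Real.exp t) / (2 * pwbMean (Real.exp t)) :=
  density_eq_nkc ht (hasDerivWithinAt_wallLeftDensity t) (uniqueDiffWithinAt_Iio t)

/-- **NO KINK IN THE ADSORBED PHASE: `ρ⁻(t) = ρ⁺(t)` at EVERY `t` with `eᵗ > μ³`** — the boundary free energy has no
corner, i.e. no first-order adsorption transition, anywhere in the regime of Kesten's identity (upgrading "almost everywhere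
differentiable"). [cite: BeatonBousquetMelouDeGierDuminilCopinGuttmann2014, §3.1, Proposition 5 (arXiv v5 p. 9: "almost everywhere differentiable")]
[cite: JansevanRensburgWhittington2013, §3.1 eq. (3.4) (arXiv v4 p. 6)] [cite: Giacomin2011, Chapter 2, Remark 2.3 ("F(·) is real analytic except at the origin … by the Implicit Function Theorem")]
[cite: HammersleyTorrieWhittington1982, §2] -/
theorem wallLeftDensity_eq_wallRightDensity_of_cube_lt (ht : hexConnectiveConstant ^ 3 < Real.exp t) :
    wallLeftDensity t = wallRightDensity t := by
  rw [wallLeftDensity_eq_visitMean_div_of_cube_lt ht, wallRightDensity_eq_visitMean_div_of_cube_lt ht]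

/-- **`κ` is differentiable at every `t > log μ³`, with `κ'(t) = V(eᵗ)/(2m(eᵗ))`.**
[cite: BeatonBousquetMelouDeGierDuminilCopinGuttmann2014, §3.1, Proposition 5 (arXiv v5 p. 9)] [cite: Giacomin2011, Chapter 2, Remark 2.3 and eq. (2.11)] -/
theorem hasDerivAt_wallFreeEnergy_of_cube_lt (ht : hexConnectiveConstant ^ 3 < Real.exp t) :
    HasDerivAt wallFreeEnergy (pwbVisitMean (Real.exp t) / (2 * pwbMean (Real.exp t))) t := by
  have hR := hasDerivWithinAt_wallRightDensity t
  have hL := hasDerivWithinAt_wallLeftDensity t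
  rw [wallRightDensity_eq_visitMean_div_of_cube_lt ht] at hR
  rw [wallLeftDensity_eq_visitMean_div_of_cube_lt ht] at hL
  have h := (hasDerivWithinAt_Iio_iff_Iic.1 hL).union (hasDerivWithinAt_Ioi_iff_Ici.1 hR)
  rwa [Set.Iic_union_Ici, hasDerivWithinAt_univ] at h

/-- `κ` is differentiable at every `t > log μ³`. [cite: BeatonBousquetMelouDeGierDuminilCopinGuttmann2014, §3.1, Proposition 5 (arXiv v5 p. 9)]
[cite: Giacomin2011, Chapter 2, Remark 2.3] -/
theorem differentiableAt_wallFreeEnergy_of_cube_lt (ht : hexConnectiveConstant ^ 3 < Real.exp t) :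
    DifferentiableAt ℝ wallFreeEnergy t :=
  (hasDerivAt_wallFreeEnergy_of_cube_lt ht).differentiableAt

/-- `κ'(t) = V(eᵗ)/(2m(eᵗ))` for `eᵗ > μ³`. [cite: Giacomin2011, Chapter 2, eq. (2.11)]
[cite: BeatonBousquetMelouDeGierDuminilCopinGuttmann2014, §3.1, Proposition 5 (arXiv v5 p. 9)] -/
theorem deriv_wallFreeEnergy_of_cube_lt (ht : hexConnectiveConstant ^ 3 < Real.exp t) :
    deriv wallFreeEnergy t = pwbVisitMean (Real.exp t) / (2 * pwbMean (Real.exp t)) :=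
  (hasDerivAt_wallFreeEnergy_of_cube_lt ht).deriv

/-- `κ` is differentiable on `(log μ³, ∞)`. [cite: BeatonBousquetMelouDeGierDuminilCopinGuttmann2014, §3.1, Proposition 5 (arXiv v5 p. 9)]
[cite: Giacomin2011, Chapter 2, Remark 2.3] -/
theorem differentiableOn_wallFreeEnergy_of_cube_lt :
    DifferentiableOn ℝ wallFreeEnergy (Set.Ioi (Real.log (hexConnectiveConstant ^ 3))) := fun t ht => by
  have h4 : 0 < hexConnectiveConstant ^ 3 := pow_pos hexConnectiveConstant_pos 3
  have ht' : hexConnectiveConstant ^ 3 < Real.exp t := by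
    have := Real.exp_lt_exp.2 (Set.mem_Ioi.1 ht)
    rwa [Real.exp_log h4] at this
  exact (differentiableAt_wallFreeEnergy_of_cube_lt ht').differentiableWithinAt

/-- **`β` is differentiable at every `y > μ³`, with `β'(y) = β(y) V(y)/(2y m(y))`.**
[cite: BeatonBousquetMelouDeGierDuminilCopinGuttmann2014, §3.1, Proposition 5 (arXiv v5 p. 9: "almost everywhere differentiable")]
[cite: Giacomin2011, Chapter 2, Remark 2.3 and eq. (2.11)] [cite: MadrasSlade1993, §4.2, Theorem 4.2.2(b) (pp. 91–92)] -/
theorem hasDerivAt_wallRate_of_cube_lt (hy : hexConnectiveConstant ^ 3 < y) :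
    HasDerivAt wallRate (wallRate y * pwbVisitMean y / (2 * y * pwbMean y)) y := by
  have hy0 : 0 < y := by have := four_le_mu_cube_nkc; linarith
  have ht : hexConnectiveConstant ^ 3 < Real.exp (Real.log y) := by rwa [Real.exp_log hy0]
  have h1 := ((hasDerivAt_wallFreeEnergy_of_cube_lt ht).comp y (Real.hasDerivAt_log hy0.ne')).exp
  rw [Real.exp_log hy0] at h1
  have hfun : wallRate =ᶠ[𝓝 y] fun x => Real.exp ((wallFreeEnergy ∘ Real.log) x) := by
    filter_upwards [Ioi_mem_nhds hy0] with x hx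
    rw [Function.comp_apply, wallFreeEnergy_apply, Real.exp_log (Set.mem_Ioi.1 hx), Real.exp_log (wallRate_pos x)]
  refine (h1.congr_of_eventuallyEq hfun).congr_deriv ?_
  rw [Function.comp_apply, wallFreeEnergy_apply, Real.exp_log hy0, Real.exp_log (wallRate_pos y)]
  have hm : 0 < pwbMean y := pwbMean_pos_of_cube_lt hy
  field_simp

/-- `β` is differentiable at every `y > μ³`. [cite: BeatonBousquetMelouDeGierDuminilCopinGuttmann2014, §3.1, Proposition 5 (arXiv v5 p. 9: "almost everywhere differentiable")]
[cite: Giacomin2011, Chapter 2, Remark 2.3] -/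
theorem differentiableAt_wallRate_of_cube_lt (hy : hexConnectiveConstant ^ 3 < y) : DifferentiableAt ℝ wallRate y :=
  (hasDerivAt_wallRate_of_cube_lt hy).differentiableAt

/-- `β` is differentiable on `(μ³, ∞)` — no first-order adsorption transition there.
[cite: BeatonBousquetMelouDeGierDuminilCopinGuttmann2014, §3.1, Proposition 5 (arXiv v5 p. 9)] [cite: HammersleyTorrieWhittington1982, §2]
[cite: Giacomin2011, Chapter 2, Remark 2.3] -/
theorem differentiableOn_wallRate_of_cube_lt : DifferentiableOn ℝ wallRate (Set.Ioi (hexConnectiveConstant ^ 3)) :=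
  fun _ hy => (differentiableAt_wallRate_of_cube_lt (Set.mem_Ioi.1 hy)).differentiableWithinAt

/-- **The logarithmic derivative of `β` is the renewal–reward ratio**: `y β'(y)/β(y) = V(y)/(2m(y))` for `y > μ³`.
[cite: Giacomin2011, Chapter 2, eq. (2.11)] [cite: JansevanRensburgWhittington2013, §3.1 eq. (3.3) (arXiv v4 p. 6)]
[cite: BeatonBousquetMelouDeGierDuminilCopinGuttmann2014, §3.1, Proposition 5 (arXiv v5 p. 9)] -/
theorem mul_deriv_wallRate_div_eq_of_cube_lt (hy : hexConnectiveConstant ^ 3 < y) :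
    y * deriv wallRate y / wallRate y = pwbVisitMean y / (2 * pwbMean y) := by
  have hy0 : 0 < y := by have := four_le_mu_cube_nkc; linarith
  have hm : 0 < pwbMean y := pwbMean_pos_of_cube_lt hy
  have hβ : 0 < wallRate y := wallRate_pos y
  rw [(hasDerivAt_wallRate_of_cube_lt hy).deriv]
  field_simp

/-! ### §5 Corollary: the density window from `1 ≤ V ≤ (m+1)/2` -/

/-- **The same-point density window, as a corollary of the identity**: `1/(2m) ≤ ρ⁺(t) ≤ (m+1)/(4m)`, `m = m(eᵗ)`, `eᵗ > μ³`
(`1 ≤ V ≤ (m+1)/2`). [cite: MadrasSlade1993, §4.2, remark before (4.2.21) (p. 94)] [cite: Giacomin2011, Chapter 2, eq. (2.11)]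
[cite: BeatonBousquetMelouDeGierDuminilCopinGuttmann2014, §3.1, Proposition 5 (arXiv v5 p. 9)] -/
theorem wallRightDensity_mem_Icc_visitMean_of_cube_lt (ht : hexConnectiveConstant ^ 3 < Real.exp t) :
    wallRightDensity t ∈ Set.Icc (1 / (2 * pwbMean (Real.exp t)))
      ((pwbMean (Real.exp t) + 1) / (4 * pwbMean (Real.exp t))) := by
  rw [wallRightDensity_eq_visitMean_div_of_cube_lt ht]
  have hm := pwbMean_pos_of_cube_lt ht
  have h1 := one_le_pwbVisitMean_of_cube_lt ht
  have h2 := two_mul_pwbVisitMean_le_of_cube_lt ht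
  constructor
  · exact div_le_div_of_nonneg_right h1 (by positivity)
  · rw [div_le_div_iff₀ (by positivity) (by positivity)]
    nlinarith

/-- The window for `ρ⁻(t)` (equal to `ρ⁺(t)` in this regime). [cite: MadrasSlade1993, §4.2, remark before (4.2.21) (p. 94)]
[cite: JansevanRensburgWhittington2013, §3.1 eq. (3.4) (arXiv v4 p. 6)] -/
theorem wallLeftDensity_mem_Icc_visitMean_of_cube_lt (ht : hexConnectiveConstant ^ 3 < Real.exp t) :
    wallLeftDensity t ∈ Set.Icc (1 / (2 * pwbMean (Real.exp t)))
      ((pwbMean (Real.exp t) + 1) / (4 * pwbMean (Real.exp t))) := by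
  rw [wallLeftDensity_eq_wallRightDensity_of_cube_lt ht]; exact wallRightDensity_mem_Icc_visitMean_of_cube_lt ht


/-! ### §6 The six-step window for the density: `3V ≤ m + 2f₁`, hence `ρ ≤ 1/6 + f₁/(3m)` on `y > μ³` -/

/-- **`3Λ^v_{2s}(y) ≤ s·Λ_{2s}(y)`** for `y ≥ 0` and `s ≥ 2` (the six-step law `6·visits ≤ 2s` termwise).
[cite: MadrasSlade1993, §4.2, remark before (4.2.21) (p. 94: an irreducible bridge of span L has at least 3L steps)] -/
theorem three_mul_IPWBV_le {s : ℕ} (hs : 2 ≤ s) (hy : 0 ≤ y) : 3 * IPWBV (2 * s) y ≤ (s : ℝ) * IPWB (2 * s) y := by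
  rw [IPWB, IPWBV, Finset.mul_sum, Finset.mul_sum]
  refine Finset.sum_le_sum fun ω hω => ?_
  have h6 : (3 : ℝ) * visits (2 * s) ω ≤ s := by exact_mod_cast three_mul_visits_le hω hs
  have h0 : 0 ≤ y ^ visits (2 * s) ω := pow_nonneg hy _
  nlinarith

/-- `Λ^v_2(y) = Λ_2(y)`: the two-step block has exactly one visit. [cite: MadrasSlade1993, §4.2, (4.2.2)]
[cite: BeatonBousquetMelouDeGierDuminilCopinGuttmann2014, §3.1 (arXiv v5 p. 9: walks sticking to the surface)] -/
theorem IPWBV_two_eq (y : ℝ) : IPWBV 2 y = IPWB 2 y := by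
  rw [IPWB, IPWBV]
  refine Finset.sum_congr rfl fun ω hω => ?_
  have h1 : 1 ≤ visits 2 ω := one_le_visits_of_mem_ipwb hω
  have h2 : visits 2 ω ≤ 1 := by
    have := four_mul_visits_le hω
    omega
  have : visits 2 ω = 1 := le_antisymm h2 h1
  rw [this, Nat.cast_one, one_mul]

/-- **The six-step window for the mean visit number**: `3V(y) ≤ m(y) + 2f₁(y)` for `y > μ³` (`3·visits ≤ s` on blocks of
half-length `s ≥ 2`, one visit on the two-step block). Sharpens the parent's `2V ≤ m + 1` (from `4·visits ≤ 2s + 2`).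
[cite: MadrasSlade1993, §4.2, remark before (4.2.21) (p. 94)] [cite: MadrasSlade1993, §4.2, Theorem 4.2.2(b) (pp. 91–92)] -/
theorem three_mul_pwbVisitMean_le_of_cube_lt (hy : hexConnectiveConstant ^ 3 < y) :
    3 * pwbVisitMean y ≤ pwbMean y + 2 * pwbLaw y 1 := by
  have hy0 : 0 < y := by have := four_le_mu_cube_nkc; linarith
  have h3 : HasSum (fun s : ℕ => 3 * (IPWBV (2 * s) y / wallRate y ^ (2 * s))) (3 * pwbVisitMean y) :=
    (summable_IPWBV_div_of_cube_lt hy).hasSum.mul_left 3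
  have hδ : HasSum (fun s : ℕ => if s = 1 then 2 * pwbLaw y 1 else 0) (2 * pwbLaw y 1) := hasSum_ite_eq 1 _
  have hm : HasSum (fun s : ℕ => (s : ℝ) * pwbLaw y s + (if s = 1 then 2 * pwbLaw y 1 else 0))
      (pwbMean y + 2 * pwbLaw y 1) := (summable_mul_pwbLaw_of_cube_lt hy).hasSum.add hδ
  refine hasSum_le (fun s => ?_) h3 hm
  have hB : 0 < wallRate y ^ (2 * s) := pow_pos (wallRate_pos y) _
  rcases Nat.lt_or_ge s 2 with hs | hs
  · interval_cases s
    · simp [IPWBV_zero, pwbLaw_zero]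
    · simp only [if_true, Nat.cast_one, one_mul, pwbLaw, Nat.mul_one, IPWBV_two_eq]
      have : 0 ≤ IPWB 2 y / wallRate y ^ 2 := div_nonneg (IPWB_nonneg _ hy0.le) (pow_nonneg (wallRate_pos y).le _)
      linarith
  · have hne : s ≠ 1 := by omega
    rw [if_neg hne, add_zero, pwbLaw, mul_div_assoc', mul_div_assoc']
    exact div_le_div_of_nonneg_right (three_mul_IPWBV_le hs hy0.le) hB.le

/-- **The six-step density window**: `ρ⁺(t) ≤ (m + 2f₁)/(6m) = 1/6 + f₁/(3m)` at every `t` with `eᵗ = y > μ³` (`m = m(y)`,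
`f₁ = f₁(y) = y/β(y)² ≤ 1`): two-step blocks contribute density `1/2`, every longer block at most `1/6`. Sharpens the parent's
`ρ⁺ ≤ (m+1)/(4m)`. [cite: Giacomin2011, Chapter 2, eq. (2.11)] [cite: MadrasSlade1993, §4.2, remark before (4.2.21) (p. 94)]
[cite: BeatonBousquetMelouDeGierDuminilCopinGuttmann2014, §3.1, Proposition 5 (arXiv v5 p. 9)] -/
theorem wallRightDensity_le_sixth_window_of_cube_lt (ht : hexConnectiveConstant ^ 3 < Real.exp t) :
    wallRightDensity t ≤ (pwbMean (Real.exp t) + 2 * pwbLaw (Real.exp t) 1) / (6 * pwbMean (Real.exp t)) := by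
  rw [wallRightDensity_eq_visitMean_div_of_cube_lt ht]
  have hm := pwbMean_pos_of_cube_lt ht
  have h3 := three_mul_pwbVisitMean_le_of_cube_lt ht
  rw [div_le_div_iff₀ (by positivity) (by positivity)]
  nlinarith

/-- The same window for `ρ⁻(t)` (equal to `ρ⁺(t)` on this range). [cite: Giacomin2011, Chapter 2, eq. (2.11)]
[cite: JansevanRensburgWhittington2013, §3.1 eq. (3.4) (arXiv v4 p. 6)] -/
theorem wallLeftDensity_le_sixth_window_of_cube_lt (ht : hexConnectiveConstant ^ 3 < Real.exp t) :
    wallLeftDensity t ≤ (pwbMean (Real.exp t) + 2 * pwbLaw (Real.exp t) 1) / (6 * pwbMean (Real.exp t)) := by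
  rw [wallLeftDensity_eq_wallRightDensity_of_cube_lt ht]; exact wallRightDensity_le_sixth_window_of_cube_lt ht

/-- The crude form: `ρ⁺(t) ≤ 1/6 + 1/(3 m(y))` (using `f₁ ≤ 1`), at every `eᵗ = y > μ³`.
[cite: Giacomin2011, Chapter 2, eq. (2.11)] [cite: MadrasSlade1993, §4.2, remark before (4.2.21) (p. 94)] -/
theorem wallRightDensity_le_sixth_add_of_cube_lt (ht : hexConnectiveConstant ^ 3 < Real.exp t) :
    wallRightDensity t ≤ 1 / 6 + 1 / (3 * pwbMean (Real.exp t)) := by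
  have hm := pwbMean_pos_of_cube_lt ht
  have hy0 : 0 < Real.exp t := Real.exp_pos t
  have hf1 : pwbLaw (Real.exp t) 1 ≤ 1 := (pwbLaw_le_pwbAmp hy0.le 1).trans (pwbAmp_le_one hy0 1)
  calc wallRightDensity t ≤ (pwbMean (Real.exp t) + 2 * pwbLaw (Real.exp t) 1) / (6 * pwbMean (Real.exp t)) :=
        wallRightDensity_le_sixth_window_of_cube_lt ht
    _ ≤ (pwbMean (Real.exp t) + 2 * 1) / (6 * pwbMean (Real.exp t)) :=
        div_le_div_of_nonneg_right (by linarith) (by positivity)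
    _ = 1 / 6 + 1 / (3 * pwbMean (Real.exp t)) := by field_simp; ring

end Literature.Probability.RandomPlanarGeometry.SAW.HexBW.Wall

end
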